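/-
Copyright (c) 2026 the pub-hodgecm-mathlib formalisation cell (harness21).  Prover seat hodgecm-mathlib-R90-IF-p01 (g2), programme R90-TF, section S9 «InnerForm-13.3.6 (c)»,
re-deal (B′2) «`hsepL` ★-census; if S9-payable from ★ material, HEADS for `Theorems/R90S9LanglandsLemmaAtLevel.lean` and pay it» (R90-IF-plan (g2) 2026-09-04T23:05:56Z).
-/
import Summits.HodgeConjecture.HodgeConjecture.Theorems.R90S9InnerFormSec146Levels   -- ★ (R90-IF-p04 (g2)): `Level`, `Evp`, `HeckeOff := UnrTensor`, `evOff`, `evpOfClass`, `EvpSupport`; cone ★ `F0P3UnrTensorInstance` (`hatOf`, `single`, `unit`, `star`, `mul`)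
import Literature.NumberTheory.Automorphic.CharacterLinIndepProduct                      -- ★ `IsCountablyLinIndepOn` (the shape of Prop. 13.8.1, as in ★ (δ5)∕(δ6a)'s binder `hsepL`)
import Literature.Topology.SummableDiracCombSeparation                                 -- ★ `Literature.Topology.separation_of_injective_bounded_starClosed` (Stone–Weierstrass ∕ Urysohn: the abstract «separating by Hecke eigenvalues»)
import Literature.NumberTheory.Automorphic.LocalUnitaryGroupUnimodularOfAdelic        -- ★ p818298 `UnitaryGroup.isInvInvariant_cmDatum_local_of_anisotropic` (unimodularity of `U(H)(L⁺_v)`, anisotropic `H`)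
import HarnessLib

/-!
# R90-TF · S9 «InnerForm-13.3.6 (c)» — LANGLANDS' LEMMA AT A LEVEL for the definite inner form `G′ = U(H)`: the Hecke eigenvalue packages of unitary unramified origin
# are COUNTABLY LINEARLY INDEPENDENT against the unramified Hecke algebra `⊗_{v∉S′} 𝓗_v` (Rogawski 1990 §13.7 p. 206, Prop. 13.8.1; Labesse–Langlands 1979 Lemma 6.1)

Cell `hodgecm-mathlib`, crux H413 (`stmt-HodgeConjecture-24833`, lane `--supports … --as helper`), route of record `HCCMUnconditional` (count-neutral).  Programme R90-TF (brief
`director/R90-BRIEF.v2.md` 1f40d54518340a35), section S9 = InnerForm-13.3.6 (c) (base `R90-IF`); seat R90-IF-p01 (g2).  Theorems only (no `def`, no instance, no notation, no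
named-fact hypothesis, no `sorry`); imports ★ `Theorems` + ★ `Literature` only.

WHAT THIS FILE IS.  The binder `hsepL` of ★ (δ5)∕(δ6a) `R90.S9.definiteAeRigidity_ofLevelPins ∕ _ofDeepLevelPins` (FILE B ED. 4 row 26 `sock_S9_sepL_cm`, until now a junction
socket «E1∕S10»),
  `∀ l : Level L, IsCountablyLinIndepOn (EvpSupport L H μv l) (fun _ : HeckeOff L H l => True) (evOff L H μv l)`,
PROVED from ★ material, for ANISOTROPIC `H` and Haar measures `μ_v` on the `U(H)(L⁺_v)`: if `b : Evp → ℂ` is supported on the packages `t = (t_v)_v` that vanish at the level and are,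
off the level, normalised eigencharacters of admissible UNITARIZABLE `K_v`-spherical classes, and `Σ_t b(t) F^(t)` is (absolutely) summable with sum `0` for every unramified pure tensor
`F ∈ ⊗_{v∉S′} 𝓗_v` (`F^(t) = ∏_{v∈T} μ_v(K_v) t_v(F_v)`, ★ `evOff`), then `b = 0`.
PROOF («separating by Hecke eigenvalues», [Rogawski1990, §13.7 p. 206; Langlands1980, pp. 208–211; LabesseLanglands1979, Lemma 6.1]): renormalise `F^(t) = c_F · F^{∧}(t)` with
`c_F := ∏_{v∈T} μ_v(K_v) ≠ 0` (compact open `K_v`) and `F^{∧}(t) := ∏_{v∈T} t_v(F_v)` (★ `UnrTensor.hatOf`), restrict to the subtype of supported packages, and apply the ★ abstract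
theorem `Literature.Topology.separation_of_injective_bounded_starClosed` (Stone–Weierstrass + Urysohn on the compact closure of the bounded image), whose five structural hypotheses
hold here: (i) INJECTIVE — a package off the level is read off the single-place tensors `𝟙 ⊗ ⋯ ⊗ f_v ⊗ ⋯ ⊗ 𝟙` (★ `UnrTensor.single`, junk convention of ★ `IrrClass.eigencharacter`);
(ii) BOUNDED — `‖t_v(f)‖ ≤ μ_v(K_v)⁻¹ ‖f‖₁` for unitarizable spherical classes (★ `IrrClass.norm_eigencharacter_le_inv_mul_integral_norm`, Langlands' bound); (iii) PRODUCTS —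
★ `UnrTensor.hatOf_mul` (`t_v(f ⋆ g) = μ_v(K_v) t_v(f) t_v(g)`, ★ p817782∕p817360); (iv) STAR — ★ `UnrTensor.hatOf_star` (`t_v(f^*) = conj t_v(f)` for unitarizable classes on the
UNIMODULAR `U(H)(L⁺_v)`: ★ `isInvInvariant_cmDatum_local_of_anisotropic`, anisotropic `H`); (v) UNIT — ★ `UnrTensor.hatOf_unit`.
Binders: `(L H) (hanis) (μv) (hμ : ∀ v, IsHaarMeasure (μv v)) (l)` — all present in (δ6a)'s telescope (`hanis` :119, `μv hμ` :173–:174), so FILE B pays row 26 BY NAME: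
`hsepL := isCountablyLinIndepOn_evOff L H hanis νG isHaar_νG`.  No `sorry`; axioms `propext`, `Classical.choice`, `Quot.sound`.
HONEST LABEL: HC_CM is proved only modulo the 7 printed citations (2 remaining named inputs: hLiu418 = stmt-HodgeConjecture-24832, h413 = stmt-HodgeConjecture-24833) until rung 0
closes.  This file discharges ONE junction leaf of the S9 pay line (Langlands' lemma at a level) from in-house ★ analysis; no count moves until B ED. 4 is BUILT and re-counted.

## References
* [Rogawski1990] J. D. Rogawski, *Automorphic Representations of Unitary Groups in Three Variables*, Ann. of Math. Stud. 123 (1990), §13.7 p. 206, Prop. 13.8.1 p. 212, §14.6 p. 242.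
* [LabesseLanglands1979] J.-P. Labesse, R. P. Langlands, *L-indistinguishability for SL(2)*, Canad. J. Math. 31 (1979), Lemma 6.1 pp. 768–769.
* [Langlands1980] R. P. Langlands, *Base change for GL(2)*, Ann. of Math. Stud. 96 (1980), pp. 208–211.
* [CartierCorvallis1979] P. Cartier, *Representations of p-adic groups: a survey*, Proc. Sympos. Pure Math. 33.1 (1979), §IV.1 Cor. 4.1.
-/

set_option autoImplicit false
set_option linter.dupNamespace false  -- the mandated namespace repeats the summit's segment (`HodgeConjecture.HodgeConjecture`)

noncomputable section

open NumberField IsDedekindDomain MeasureTheory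
open scoped ComplexConjugate
open Literature.NumberTheory Literature.NumberTheory.Automorphic Literature.NumberTheory.Automorphic.UnitaryGroup
open Summit.HodgeConjecture.HodgeConjecture.Cruxes.H413
open Summit.HodgeConjecture.HodgeConjecture.Cruxes.H413.F0P3UnrTensorInstance (UnrTensor)

namespace Summit.HodgeConjecture.HodgeConjecture.R90.S9.InnerFormSec146

open scoped Classical in
/-- **LANGLANDS' LEMMA AT A LEVEL («separating by Hecke eigenvalues») for `G′ = U(H)`, `H` anisotropic** — the binder `hsepL` of ★ `definiteAeRigidity_ofDeepLevelPins` (FILE B ED. 4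
row 26), PROVED: for every level `S′ = l`, the packages `t ∈ EvpSupport l` (zero at the level; off it, normalised eigencharacters of admissible unitarizable `K_v`-spherical classes) are
countably linearly independent against the unramified pure tensors `F ∈ ⊗_{v∉S′} 𝓗_v` through `F^(t) = ∏_{v∈T} μ_v(K_v) t_v(F_v)` (★ `evOff`): `Σ_t b(t) F^(t)` summable and `= 0` for all
`F`, `b` supported on `EvpSupport l` ⟹ `b = 0`.  Proof: renormalise to ★ `UnrTensor.hatOf` (`c_F = ∏ μ_v(K_v) ≠ 0`), restrict to the subtype of supported packages, and apply ★
`Literature.Topology.separation_of_injective_bounded_starClosed` with: injectivity via ★ `UnrTensor.single`; Langlands' bound ★ `IrrClass.norm_eigencharacter_le_inv_mul_integral_norm`;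
products ★ `UnrTensor.hatOf_mul`; star ★ `UnrTensor.hatOf_star` on the unimodular `U(H)(L⁺_v)` (★ `isInvInvariant_cmDatum_local_of_anisotropic`); unit ★ `UnrTensor.hatOf_unit`.
[cite: Rogawski1990, §13.7 p. 206; Prop. 13.8.1 p. 212] [cite: LabesseLanglands1979, Lemma 6.1] [cite: Langlands1980, pp. 208–211] [cite: CartierCorvallis1979, §IV.1 Cor. 4.1] -/
theorem isCountablyLinIndepOn_evOff
    (L : Type) [Field L] [NumberField L] [IsCMField L] (H : Matrix (Fin 3) (Fin 3) L)
    (hanis : ∀ x : Fin 3 → L, Literature.AlgebraicGeometry.ShimuraVarieties.hermForm (cmConjRingHom L) H x x = 0 → x = 0)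
    (μv : ∀ v : HeightOneSpectrum (𝓞 ↥(maximalRealSubfield L)), @Measure ((cmDatum L 3 H).Local v) (borel _))
    (hμ : ∀ v, letI : MeasurableSpace ((cmDatum L 3 H).Local v) := borel _; (μv v).IsHaarMeasure)
    (l : Level L) :
    IsCountablyLinIndepOn (EvpSupport L H μv l) (fun _ : HeckeOff L H l => True) (evOff L H μv l) := by
  letI : ∀ v, MeasurableSpace ((cmDatum L 3 H).Local v) := fun _ => borel _
  haveI : ∀ v, BorelSpace ((cmDatum L 3 H).Local v) := fun _ => ⟨rfl⟩
  haveI : ∀ v, (μv v).IsHaarMeasure := hμ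
  intro b hbU hsum hzero e₀
  -- off the support there is nothing to prove
  by_cases he₀ : e₀ ∈ EvpSupport L H μv l
  swap
  · by_contra h
    exact he₀ (hbU e₀ h)
  -- `K_v` compact open, `μ_v(K_v) ≠ 0`
  have hK : ∀ v : HeightOneSpectrum (𝓞 ↥(maximalRealSubfield L)),
      IsCompact (cmLocalIntegralLevel L 3 H v : Set ((cmDatum L 3 H).Local v)) ∧ IsOpen (cmLocalIntegralLevel L 3 H v : Set ((cmDatum L 3 H).Local v)) :=
    fun v => isCompact_isOpen_cmLocalIntegralLevel L 3 H v
  have hμK : ∀ v : HeightOneSpectrum (𝓞 ↥(maximalRealSubfield L)), (μv v).real (cmLocalIntegralLevel L 3 H v : Set ((cmDatum L 3 H).Local v)) ≠ 0 :=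
    fun v => UnrTensor.measureReal_cmLocalIntegralLevel_ne_zero μv v (hμ v)
  -- RENORMALISATION: `F^(t) = c_F · F^{∧}(t)` with `c_F = ∏_{v ∈ T} μ_v(K_v) ≠ 0`
  have hcF : ∀ F : HeckeOff L H l,
      (∏ v ∈ F.T, (((μv v).real (cmLocalIntegralLevel L 3 H v : Set ((cmDatum L 3 H).Local v)) : ℝ) : ℂ)) ≠ 0 :=
    fun F => Finset.prod_ne_zero_iff.2 fun v _ => Complex.ofReal_ne_zero.2 (hμK v)
  have hev : ∀ (e : Evp L H) (F : HeckeOff L H l),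
      evOff L H μv l e F = (∏ v ∈ F.T, (((μv v).real (cmLocalIntegralLevel L 3 H v : Set ((cmDatum L 3 H).Local v)) : ℝ) : ℂ)) * UnrTensor.hatOf e F := by
    intro e F
    rw [evOff_def, UnrTensor.hatOf_def, ← Finset.prod_mul_distrib]
  -- THE CLASS FAMILY of a supported package: off the level, admissible unitarizable classes spherical WITH the package's local functional
  have hcls : ∀ e : ↥(EvpSupport L H μv l), ∃ c : ∀ v : HeightOneSpectrum (𝓞 ↥(maximalRealSubfield L)), IrrClass ((cmDatum L 3 H).Local v),
      ∀ v, v ∉ l → (c v).IsAdmissible ∧ (c v).IsUnitarizable ∧ (c v).IsSphericalWith (cmLocalIntegralLevel L 3 H v) (μv v) (e.1 v) := by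
    intro e
    have h := e.2.2
    refine ⟨fun v => if hv : v ∈ l then F0P3ClassTokenChoice.trivialClass v else (h v hv).choose, fun v hv => ?_⟩
    dsimp only
    rw [dif_neg hv]
    obtain ⟨hadm, hsph, hu, heq⟩ := (h v hv).choose_spec
    refine ⟨hadm, hu, ?_⟩
    have hsw := IrrClass.IsSpherical.isSphericalWith_eigencharacter (μv v) hadm (hK v).2 (hK v).1 (hμK v) hsph
    convert hsw using 1
    exact heq
  -- THE NORMALISED HAT on the subtype of supported packages, and the coefficient family there
  -- (1) summability and (2) vanishing transfer from `evOff` to the normalised hat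
  have hsumE : ∀ F : HeckeOff L H l, Summable fun e : ↥(EvpSupport L H μv l) => b e.1 * UnrTensor.hatOf e.1 F := by
    intro F
    have h1 : Summable fun e : ↥(EvpSupport L H μv l) => b e.1 * evOff L H μv l e.1 F := (hsum F trivial).subtype _
    refine (h1.mul_left (∏ v ∈ F.T, (((μv v).real (cmLocalIntegralLevel L 3 H v : Set ((cmDatum L 3 H).Local v)) : ℝ) : ℂ))⁻¹).congr fun e => ?_
    show _ = b e.1 * UnrTensor.hatOf e.1 F
    rw [hev, mul_left_comm (b e.1), ← mul_assoc, inv_mul_cancel₀ (hcF F), one_mul]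
  have hzeroE : ∀ F : HeckeOff L H l, ∑' e : ↥(EvpSupport L H μv l), b e.1 * UnrTensor.hatOf e.1 F = 0 := by
    intro F
    have hsupp : Function.support (fun e : Evp L H => b e * evOff L H μv l e F) ⊆ EvpSupport L H μv l :=
      fun e he => hbU e (left_ne_zero_of_mul (Function.mem_support.1 he))
    have h1 : ∑' e : ↥(EvpSupport L H μv l), b e.1 * evOff L H μv l e.1 F = ∑' e : Evp L H, b e * evOff L H μv l e F :=
      tsum_subtype_eq_of_support_subset hsupp
    have h2 : ∀ e : ↥(EvpSupport L H μv l), b e.1 * UnrTensor.hatOf e.1 F =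
        (∏ v ∈ F.T, (((μv v).real (cmLocalIntegralLevel L 3 H v : Set ((cmDatum L 3 H).Local v)) : ℝ) : ℂ))⁻¹ * (b e.1 * evOff L H μv l e.1 F) := by
      intro e
      rw [hev, mul_left_comm (b e.1), ← mul_assoc, inv_mul_cancel₀ (hcF F), one_mul]
    rw [tsum_congr h2, tsum_mul_left, h1, hzero F trivial, mul_zero]
  -- (3) THE FIVE STRUCTURAL HYPOTHESES of the abstract separation theorem
  -- (i) INJECTIVE: a package off the level is read off the single-place tensors; at the level both vanish; off `C_c(K_v\G′_v/K_v)` both are junk `0`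
  have hinj : Function.Injective (fun e : ↥(EvpSupport L H μv l) => fun F : HeckeOff L H l => UnrTensor.hatOf e.1 F) := by
    rintro ⟨e, he⟩ ⟨e', he'⟩ h
    apply Subtype.ext
    change e = e'
    funext v
    by_cases hv : v ∈ l
    · rw [he.1 v hv, he'.1 v hv]
    · funext f
      by_cases hf : HasCompactSupport f ∧ IsLevel (cmLocalIntegralLevel L 3 H v) f
      · have h1 := congrFun h (UnrTensor.single v hv f hf.1 hf.2)
        simpa only [UnrTensor.hatOf_single] using h1
      · obtain ⟨c, -, -, -, hc⟩ := he.2 v hv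
        obtain ⟨c', -, -, -, hc'⟩ := he'.2 v hv
        rw [hc, hc']
        show (c.eigencharacter (cmLocalIntegralLevel L 3 H v) (μv v)) f = (c'.eigencharacter (cmLocalIntegralLevel L 3 H v) (μv v)) f
        rw [IrrClass.eigencharacter_of_not c _ _ hf, IrrClass.eigencharacter_of_not c' _ _ hf]
  -- (ii) BOUNDED (Langlands' bound, unitarizable spherical classes): `‖F^{∧}(t)‖ ≤ ∏_{v∈T} μ_v(K_v)⁻¹ ‖F_v‖₁`
  have hbdd : ∀ F : HeckeOff L H l, ∃ C : ℝ, ∀ e : ↥(EvpSupport L H μv l), ‖(fun F : HeckeOff L H l => UnrTensor.hatOf e.1 F) F‖ ≤ C := by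
    intro F
    refine ⟨∏ v ∈ F.T, (((μv v).real (cmLocalIntegralLevel L 3 H v : Set ((cmDatum L 3 H).Local v)))⁻¹ * ∫ g, ‖F.loc v g‖ ∂(μv v)), fun e => ?_⟩
    show ‖UnrTensor.hatOf e.1 F‖ ≤ _
    rw [UnrTensor.hatOf_def, norm_prod]
    refine Finset.prod_le_prod (fun v _ => norm_nonneg _) fun v hv => ?_
    have hvl : v ∉ l := Finset.disjoint_left.1 F.hT hv
    obtain ⟨c, hadm, hsph, hu, hc⟩ := e.2.2 v hvl
    rw [hc]
    exact IrrClass.norm_eigencharacter_le_inv_mul_integral_norm (μv v) hadm hu hsph (F.loc v)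
  -- (iii) PRODUCTS: `(F ⋆ G)^{∧}(t) = F^{∧}(t) G^{∧}(t)` (normalised placewise convolution)
  have hmul : ∀ F G : HeckeOff L H l, ∃ W : HeckeOff L H l, ∀ e : ↥(EvpSupport L H μv l),
      (fun F : HeckeOff L H l => UnrTensor.hatOf e.1 F) W =
        (fun F : HeckeOff L H l => UnrTensor.hatOf e.1 F) F * (fun F : HeckeOff L H l => UnrTensor.hatOf e.1 F) G := by
    intro F G
    refine ⟨UnrTensor.mul μv (fun v => (hμ v).toIsMulLeftInvariant) F G, fun e => ?_⟩
    obtain ⟨c, hc⟩ := hcls e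
    exact UnrTensor.hatOf_mul μv hμ F G e.1 c fun v hv => ⟨(hc v hv).1, (hc v hv).2.2⟩
  -- (iv) STAR: `(F^*)^{∧}(t) = conj F^{∧}(t)` (unitarizable classes; `U(H)(L⁺_v)` unimodular for anisotropic `H`)
  have hstar : ∀ F : HeckeOff L H l, ∃ W : HeckeOff L H l, ∀ e : ↥(EvpSupport L H μv l),
      (fun F : HeckeOff L H l => UnrTensor.hatOf e.1 F) W = conj ((fun F : HeckeOff L H l => UnrTensor.hatOf e.1 F) F) := by
    intro F
    refine ⟨UnrTensor.star F, fun e => ?_⟩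
    obtain ⟨c, hc⟩ := hcls e
    exact UnrTensor.hatOf_star μv hμ (fun v => UnitaryGroup.isInvInvariant_cmDatum_local_of_anisotropic L H v hanis (μv v)) F e.1 c hc
  -- (v) UNIT: `𝟙^{∧}(t) = 1`
  have hone : ∃ u : HeckeOff L H l, ∀ e : ↥(EvpSupport L H μv l), (fun F : HeckeOff L H l => UnrTensor.hatOf e.1 F) u = 1 :=
    ⟨UnrTensor.unit, fun e => UnrTensor.hatOf_unit e.1⟩
  -- (4) «SEPARATING BY HECKE EIGENVALUES»
  exact Literature.Topology.separation_of_injective_bounded_starClosed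
    (fun e : ↥(EvpSupport L H μv l) => fun F : HeckeOff L H l => UnrTensor.hatOf e.1 F) hinj hbdd hmul hstar hone
    (fun e => b e.1) hsumE hzeroE ⟨e₀, he₀⟩

end Summit.HodgeConjecture.HodgeConjecture.R90.S9.InnerFormSec146

end
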